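import Mathlib
import Literature.NumberTheory.Sieve.Maynard2016Lemma7CoupledLink
import HarnessLib

/-!
# Maynard (2016), Lemma 7: the weight `1/φ(r)` is `1/φ(lcm(∏[d_j,d'_j], ∏[e_l,e'_l]))`

Topic `Literature/NumberTheory/Sieve`; trunk AntSieve / parity (Maynard 2016 large-gaps ladder, named
fact `Literature.NumberTheory.Sieve.Maynard2016.Lemma7Tuple` of `Maynard2016Lemma7PerTuple.lean`).

J. Maynard, *Large gaps between primes*, Ann. of Math. (2) 183 (2016), 915–933 = arXiv:1408.5110,
§6, proof of Lemma 7, displays (6.28) and (6.32): the inner sum is a sum over primes in arithmetic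
progressions "modulo `r`, the radical of `∏_j [d_j,d'_j][e_j,e'_j]`", and the main term carries the
weight `1/φ(r)`.  On the contributing (coupled-admissible, `Maynard2016Lemma7CoupledLink`) tuples the
products `∏_j [d_j,d'_j]` and `∏_l [e_l,e'_l]` are squarefree, so that
`r = lcm(∏_j [d_j,d'_j], ∏_l [e_l,e'_l])` — the modulus of the coupled Euler-product engine of
Lemma 6 (`Maynard2016CoupledEuler.coupledSummand`, denominator `lcm(∏ D, ∏ E)`), now to be run with
the multiplicative weight `w(n) = 1/φ(n)` in place of `1/n` (cf. the one-sided weighted engine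
`PolymathLcmSumsEuler.sum_pairBox_filter_eq_prod_weight`).

PROVED here (no named facts): `squarefree_prod_of_pairwise_coprime`,
`prod_primeFactors_mul_eq_lcm` (`rad(ab) = lcm(a,b)` for squarefree `a, b`),
`radMod_eq_lcm_of_coupledAdm`, and the pointwise rewriting of the main-term summand
`summand_sysSolvable_eq_coupledAdm`:
`[SysSolvable] a/φ(radMod) = [CoupledAdm P_w m (couplingSet7 p₀)] a/φ(lcm(∏ D, ∏ E))`.

## References

* J. Maynard, *Large gaps between primes*, Ann. of Math. (2) 183 (2016), 915–933; arXiv:1408.5110,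
  §6, proof of Lemma 7, displays (6.28), (6.32). [Maynard2016LargeGaps]
-/

noncomputable section

open Finset
open scoped BigOperators Classical

namespace Literature.NumberTheory.Sieve

namespace Maynard2016

open LcmEuler

variable {k : ℕ}

/-! ### Squarefree products and radicals -/

/-- A product of pairwise coprime squarefree numbers is squarefree. [cite: Maynard2016LargeGaps, Lemma 7 (proof, display (6.28))] -/
theorem squarefree_prod_of_pairwise_coprime {ι : Type*} (s : Finset ι) {f : ι → ℕ}
    (hsq : ∀ i ∈ s, Squarefree (f i)) (hcop : ∀ i ∈ s, ∀ j ∈ s, i ≠ j → Nat.Coprime (f i) (f j)) :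
    Squarefree (∏ i ∈ s, f i) := by
  classical
  induction s using Finset.induction_on with
  | empty => simp
  | @insert a s ha ih =>
    rw [Finset.prod_insert ha]
    have hc : Nat.Coprime (f a) (∏ i ∈ s, f i) :=
      Nat.Coprime.prod_right fun i hi =>
        hcop a (Finset.mem_insert_self _ _) i (Finset.mem_insert_of_mem hi)
          (fun h => ha (h ▸ hi))
    exact (Nat.squarefree_mul hc).2 ⟨hsq a (Finset.mem_insert_self _ _),
      ih (fun i hi => hsq i (Finset.mem_insert_of_mem hi))
        (fun i hi j hj hij => hcop i (Finset.mem_insert_of_mem hi) j (Finset.mem_insert_of_mem hj) hij)⟩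

/-- For squarefree `a, b`: `rad(ab) = ∏_{p ∣ ab} p = lcm(a, b)`. [cite: Maynard2016LargeGaps, Lemma 7 (proof, display (6.28))] -/
theorem prod_primeFactors_mul_eq_lcm {a b : ℕ} (ha : Squarefree a) (hb : Squarefree b) :
    ∏ p ∈ (a * b).primeFactors, p = Nat.lcm a b := by
  have ha0 : a ≠ 0 := ha.ne_zero
  have hb0 : b ≠ 0 := hb.ne_zero
  have hg : Squarefree (Nat.gcd a b) := ha.squarefree_of_dvd (Nat.gcd_dvd_left a b)
  have h1 : (∏ p ∈ a.primeFactors ∪ b.primeFactors, p) * ∏ p ∈ a.primeFactors ∩ b.primeFactors, p =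
      (∏ p ∈ a.primeFactors, p) * ∏ p ∈ b.primeFactors, p := Finset.prod_union_inter
  rw [Nat.prod_primeFactors_of_squarefree ha, Nat.prod_primeFactors_of_squarefree hb,
    ← Nat.primeFactors_gcd ha0 hb0, Nat.prod_primeFactors_of_squarefree hg,
    ← Nat.gcd_mul_lcm a b, mul_comm (Nat.gcd a b)] at h1
  rw [Nat.primeFactors_mul ha0 hb0]
  exact mul_right_cancel₀ (Nat.gcd_pos_of_pos_left b (Nat.pos_of_ne_zero ha0)).ne' h1

/-- On a coupled-admissible tuple with squarefree coordinates, the modulus `r` of (6.28) is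
`lcm(∏_j [d_j,d'_j], ∏_l [e_l,e'_l])`. [cite: Maynard2016LargeGaps, Lemma 7 (proof, displays (6.28), (6.32))] -/
theorem radMod_eq_lcm_of_coupledAdm {W m : ℕ} {M : ℕ → Finset (Fin k × Fin k)}
    {d d' e e' : Fin k → ℕ}
    (hd : ∀ j, Squarefree (d j)) (hd' : ∀ j, Squarefree (d' j)) (he : ∀ j, Squarefree (e j))
    (he' : ∀ j, Squarefree (e' j)) (hadm : CoupledAdm W m M (d, d') (e, e')) :
    radMod d d' e e' = Nat.lcm (∏ j, Nat.lcm (d j) (d' j)) (∏ l, Nat.lcm (e l) (e' l)) := by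
  rw [radMod, prod_sysD]
  refine prod_primeFactors_mul_eq_lcm ?_ ?_
  · exact squarefree_prod_of_pairwise_coprime _
      (fun j _ => sys_squarefree hd hd' he he' (Sum.inl j) (Finset.mem_univ _))
      (fun i _ j _ hij => hadm.1.1 i j hij)
  · exact squarefree_prod_of_pairwise_coprime _
      (fun j _ => sys_squarefree hd hd' he he' (Sum.inr j) (Finset.mem_univ _))
      (fun i _ j _ hij => hadm.2.1.1 i j hij)

/-! ### The main-term summand of (6.32), rewritten for the engine -/

/-- **Pointwise rewriting of the main-term summand of (6.32)**: on the support of `λλ'` with slot `i`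
trivial and for large `x`,
`[SysSolvable] a/φ(r) = [CoupledAdm P_w m (couplingSet7 p₀) (d,d') (e,e')] a/φ(lcm(∏ D, ∏ E))`.
[cite: Maynard2016LargeGaps, Lemma 7 (proof, display (6.32))] -/
theorem summand_sysSolvable_eq_coupledAdm {x m p₀ : ℕ} (hp₀ : p₀.Prime) (hm : 1 ≤ m)
    (hW : ∀ a b : Fin k, a ≠ b → ∀ p : ℕ, p.Prime →
      (p : ℤ) ∣ (hTuple k x b : ℤ) - hTuple k x a → p ∣ Pw x)
    {i : Fin k} {d d' e e' : Fin k → ℕ}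
    (hd : ∀ j, Squarefree (d j)) (hd' : ∀ j, Squarefree (d' j)) (he : ∀ j, Squarefree (e j))
    (he' : ∀ j, Squarefree (e' j)) (hdlt : ∀ j, d j * d' j < p₀)
    (hecop : ∀ j, Nat.Coprime (m * p₀ - 1) (e j * e' j))
    (hdi : d i = 1) (hdi' : d' i = 1) (hei : e i = 1) (hei' : e' i = 1) (a : ℝ) :
    (if SysSolvable k x m p₀ i d d' e e' then a / (Nat.totient (radMod d d' e e') : ℝ) else 0) =
      if CoupledAdm (Pw x) m (couplingSet7 k x m p₀ i) (d, d') (e, e') then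
        a / (Nat.totient (Nat.lcm (∏ j, Nat.lcm (d j) (d' j)) (∏ l, Nat.lcm (e l) (e' l))) : ℝ)
      else 0 := by
  rw [if_congr (sysSolvable_iff_coupledAdm hp₀ hm hW hd hd' he he' hdlt hecop hdi hdi' hei hei')
    rfl rfl]
  by_cases hadm : CoupledAdm (Pw x) m (couplingSet7 k x m p₀ i) (d, d') (e, e')
  · rw [if_pos hadm, if_pos hadm, radMod_eq_lcm_of_coupledAdm hd hd' he he' hadm]
  · rw [if_neg hadm, if_neg hadm]

end Maynard2016

end Literature.NumberTheory.Sieve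

end
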